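import Summits.Ventures.DiscreteObjects.Hadamard.AutomorphismFixedRows668
import Summits.Ventures.DiscreteObjects.Hadamard.PrimeOrderParitySelfConj

/-!
# Hadamard 668 census, family F12 — a signed automorphism of H(668) of order 3, 5, 7, 11, 13, 37 or 41 has an EVEN number of
# row orbits and of column orbits of length p (kernel)

Framing: lottery ticket; floor = certified bounds/negative ranges.

Cell pub-namedobj (venture DiscreteObjects), target (H), hadamard gen 8.  Transfer of the kernel parity theorem
`two_dvd_card_blockClasses_of_mem` (Lander 1983 Thm 3.20(2) for the 2-(667,333,166) structure, `167` self-conjugate mod `p`) to a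
Hadamard matrix `H` of order `668` with a signed-permutation automorphism `(π, κ, d, e)`, `π^p = κ^p = 1`, for the surviving odd
prime orders `p ∈ {3, 5, 7, 11, 13, 37, 41}` of the census (mod `23` and `83` the prime `167` is not self-conjugate):
**`hadamard668_signedAut_two_dvd_colClasses`** — the number of `κ`-orbits of length `p` on columns is even — and, via the transpose,
**`hadamard668_signedAut_two_dvd_rowClasses`** for the `π`-orbits on rows.  Route: `p ∤ 668` gives a fixed row `r` and column `c`
(`Equiv.Perm.exists_fixed_point_of_prime`); if `π = 1` then `κ = 1` (`signedAut_snd_eq_one`) and there is nothing to prove;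
otherwise `transfer668` produces the `0/1` structure `inc H r c` on `{i ≠ r} × {j ≠ c}` with the induced pair, the parity theorem
applies there, and the classes of `κ` on `ι` are those of its restriction (`card_fixed_add_classes`, `card_fixed_eq_succ`).
Ours, not literature; no `sorry`.
-/

open Finset BigOperators Matrix

namespace Summit.Ventures.DiscreteObjects.Hadamard

open Literature.Combinatorics.Designs.GoethalsSeidel (IsHadamardMatrix)

variable {ι : Type*} [Fintype ι] [DecidableEq ι]

omit [Fintype ι] [DecidableEq ι] in
/-- a signed automorphism of `H` gives one of `Hᵀ` with the roles of rows and columns exchanged -/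
lemma isSignedAut_transpose {H : Matrix ι ι ℤ} {π κ : Equiv.Perm ι} {d e : ι → ℤ} (haut : IsSignedAut H π κ d e) :
    IsSignedAut Hᵀ κ π e d := by
  obtain ⟨hd, he, hA⟩ := haut
  refine ⟨he, hd, fun j i => ?_⟩
  rw [Matrix.transpose_apply, Matrix.transpose_apply, hA i j]
  ring

/-- the identity permutation has no classes of moved points -/
lemma blockClasses_one (p : ℕ) : blockClasses (1 : Equiv.Perm ι) p = ∅ := by
  unfold blockClasses
  rw [Finset.image_eq_empty, Finset.filter_eq_empty_iff]
  intro y _ h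
  exact h (Equiv.Perm.one_apply y)

/-- **Even number of column orbits.**  For a Hadamard matrix of order `668` with a signed automorphism `(π, κ, d, e)`,
`π^p = κ^p = 1`, `p ∈ {3, 5, 7, 11, 13, 37, 41}`: the number of `κ`-orbits of length `p` is even. -/
theorem hadamard668_signedAut_two_dvd_colClasses {H : Matrix ι ι ℤ} (hH : IsHadamardMatrix H) (hι : Fintype.card ι = 668)
    {p : ℕ} (hmem : p = 3 ∨ p = 5 ∨ p = 7 ∨ p = 11 ∨ p = 13 ∨ p = 37 ∨ p = 41)
    (π κ : Equiv.Perm ι) (d e : ι → ℤ) (haut : IsSignedAut H π κ d e) (hπ : π ^ p = 1) (hκ : κ ^ p = 1) :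
    2 ∣ (blockClasses κ p).card := by
  have hp : p.Prime := by rcases hmem with rfl | rfl | rfl | rfl | rfl | rfl | rfl <;> norm_num
  have hodd : Odd p := by rcases hmem with rfl | rfl | rfl | rfl | rfl | rfl | rfl <;> decide
  have hpd : ¬ p ∣ 668 := by rcases hmem with rfl | rfl | rfl | rfl | rfl | rfl | rfl <;> norm_num
  have hcard : (Fintype.card ι : ℤ) ≠ 0 := by rw [hι]; norm_num
  by_cases hπ1 : π = 1
  · subst hπ1
    have hκ1 : κ = 1 := signedAut_snd_eq_one H hH hcard haut hodd hκ
    subst hκ1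
    rw [blockClasses_one, Finset.card_empty]
    exact dvd_zero 2
  · have hnd : ¬ p ∣ Fintype.card ι := by rw [hι]; exact hpd
    haveI : Fact p.Prime := ⟨hp⟩
    obtain ⟨r, hr⟩ := Equiv.Perm.exists_fixed_point_of_prime (n := 1) hnd (σ := π) (by rw [pow_one]; exact hπ)
    obtain ⟨c, hc⟩ := Equiv.Perm.exists_fixed_point_of_prime (n := 1) hnd (σ := κ) (by rw [pow_one]; exact hκ)
    obtain ⟨hπr, hκc, h01, hrow, hpair, hcol, hcpair, -, hB, hN, hρ, hτ, -⟩ :=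
      transfer668 hH hι p π κ d e haut hπ hκ hπ1 hr hc
    have h2 := two_dvd_card_blockClasses_of_mem (fun (x : {i // i ≠ r}) (y : {j // j ≠ c}) => inc H r c x.1 y.1)
      h01 hrow hpair hcol hcpair (Or.inr hmem) (π.subtypePerm hπr : Equiv.Perm {i // i ≠ r})
      (κ.subtypePerm hκc : Equiv.Perm {j // j ≠ c}) hN hρ hτ
    -- classes of the restriction of κ to {j ≠ c} are the classes of κ
    have e1 := card_fixed_add_classes (κ.subtypePerm hκc : Equiv.Perm {j // j ≠ c}) hp hτ
    have e2 := card_fixed_add_classes κ hp hκ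
    have e3 := card_fixed_eq_succ κ c hc hκc
    rw [hB] at e1
    rw [hι] at e2
    have e4 : (blockClasses (κ.subtypePerm hκc : Equiv.Perm {j // j ≠ c}) p).card * p = (blockClasses κ p).card * p := by
      omega
    rw [Nat.eq_of_mul_eq_mul_right hp.pos e4] at h2
    exact h2

/-- **Even number of row orbits** (the same for `π`, via the transpose). -/
theorem hadamard668_signedAut_two_dvd_rowClasses {H : Matrix ι ι ℤ} (hH : IsHadamardMatrix H) (hι : Fintype.card ι = 668)
    {p : ℕ} (hmem : p = 3 ∨ p = 5 ∨ p = 7 ∨ p = 11 ∨ p = 13 ∨ p = 37 ∨ p = 41)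
    (π κ : Equiv.Perm ι) (d e : ι → ℤ) (haut : IsSignedAut H π κ d e) (hπ : π ^ p = 1) (hκ : κ ^ p = 1) :
    2 ∣ (blockClasses π p).card := by
  have hcard : (Fintype.card ι : ℤ) ≠ 0 := by rw [hι]; norm_num
  exact hadamard668_signedAut_two_dvd_colClasses (isHadamard_transpose hH hcard) hι hmem κ π e d
    (isSignedAut_transpose haut) hκ hπ

end Summit.Ventures.DiscreteObjects.Hadamard
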